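import Literature.Computability.AlgebraicComplexity.MS21ANFMonomialInclusionStep
import Literature.Computability.AlgebraicComplexity.MS21ANFOneRigidity
import Literature.Computability.AlgebraicComplexity.MS21ANFOrbitsSameDepthReduction
import HarnessLib

/-!
# Medini–Shpilka 2021, Lemma 5.12 (roanfMonInc), TR-free form, all `Δ`

Theorem-only file (cell `val-lit`, seat p1 g5; brick "5.12c" for the registry fact
`MS2021_thm_35`, owner seat x5 g3) for [MediniShpilka2021, Lemma 5.12, arXiv:2102.05632
p0027:L40–L43, with the re-labelling remark after Lemma 5.11, p0027:L12–L16]: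

> "Let `g(x) = ANF_Δ(Ax + b)` for some `(A, b) ∈ GLaff_n(F)` … If `mon(g) ⊆ mon(ANF_Δ(x))`, then
> `b = 0` and `mon(q_i(Ax)) = mon(q_i(x))`, up to `TR_{4^{Δ-1}}(F)` symmetry."

MAIN RESULTS (square matrices, as consumed by the `MS2021_thm_35` core):
* `MS2021.exists_units_of_support_linSubst_anf_subset` — if `mon(ANF_Δ(Mx)) ⊆ mon(ANF_Δ)` (`M`
  invertible) then `ANF_Δ(Mx) = ANF_Δ(α • x)` for nonzero scalars `α`: in the polynomial (TR-free)
  formulation the tree symmetry is absorbed and the conclusion is DIAGONAL;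
* `MS2021.anf_rigidity_of_support_subset` — the affine version with the `b = 0` clause, in the
  signature of the consortium sizing memo (t20 g5, §2) for every `Δ` (`π = 1`);
* `MS2021.exists_units_of_support_affSubst_anf_subset` — the same in `affSubst le_rfl M 0` form
  with the diagonal matrix `Matrix.diagonal α`.
Route: induction on `Δ` with bases `Δ = 0` (one variable) and `Δ = 1`
(`MS2021.anf_one_rigidity_of_support_subset`, seat t20 g5), step `MS2021.block_step` transported
along the block equivalence `Fin 4 × Fin 4^{Δ+1} ≃ Fin 4^{Δ+2}`; the `b = 0` clause by the
first-order Taylor component (`MS2021.homogeneousComponent_affSubst_one`, seat x5 g3) and the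
independence of the first partials of `ANF_Δ` (Cor. 5.10).  No definitions, no named facts;
nothing here bears on `VP ≠ VNP`.

## References
* [MediniShpilka2021] arXiv:2102.05632, Lemma 5.12 (p0027:L40–p0028:L40), remark after Lemma 5.11
  (p0027:L12–L16), Cor. 5.10, Obs. 5.7–5.8.
-/

noncomputable section

open MvPolynomial Finset Matrix

namespace Literature.Computability.AlgebraicComplexity

namespace MS2021

variable {K : Type*} [Field K]

/-! ### The block equivalence and the hypotheses of `block_step` for `A = ANF_{Δ+1}` -/

/-- The block equivalence `(b, j) ↦ x^{(b)}_j`. [cite: MediniShpilka2021, Def 8] -/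
theorem exists_equiv_anfBlock (Δ : ℕ) :
    ∃ e : Fin 4 × Fin (4 ^ Δ) ≃ Fin (4 ^ (Δ + 1)), ∀ b j, e (b, j) = anfBlock Δ b j :=
  ⟨finProdFinEquiv.trans (finCongr (pow_succ' 4 Δ).symm), fun _ _ => rfl⟩

/-- `ANF_{Δ+1}` is the block polynomial of `ANF_Δ`, re-indexed along the block equivalence.
[cite: MediniShpilka2021, Def 8] -/
theorem anf_succ_eq_rename_block (Δ : ℕ) {e : Fin 4 × Fin (4 ^ Δ) ≃ Fin (4 ^ (Δ + 1))}
    (he : ∀ b j, e (b, j) = anfBlock Δ b j) :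
    anf K (Δ + 1) = rename e
      (rename (Prod.mk (0 : Fin 4)) (anf K Δ) * rename (Prod.mk (1 : Fin 4)) (anf K Δ) +
        rename (Prod.mk (2 : Fin 4)) (anf K Δ) * rename (Prod.mk (3 : Fin 4)) (anf K Δ)) := by
  have hr : ∀ b : Fin 4, rename e (rename (Prod.mk b) (anf K Δ)) = rename (anfBlock Δ b) (anf K Δ) := by
    intro b
    rw [rename_rename]
    exact congrArg (fun f : Fin (4 ^ Δ) → Fin (4 ^ (Δ + 1)) => rename f (anf K Δ))
      (funext fun j => he b j)
  rw [anf_succ, map_add, map_mul, map_mul, hr, hr, hr, hr]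

/-- Sibling property of `ANF_{Δ+1}`: every monomial containing `x_i` contains its sibling.
[cite: MediniShpilka2021, Obs 5.7 (arXiv p0025:L50-L53)] -/
theorem exists_sibling_of_mem_support_anf (Δ : ℕ) (i : Fin (4 ^ (Δ + 1))) :
    ∃ i' : Fin (4 ^ (Δ + 1)), i' ≠ i ∧ ∀ m ∈ (anf K (Δ + 1)).support, m i ≠ 0 → m i' ≠ 0 := by
  classical
  obtain ⟨i', hi', P, R, hanf, -, -, -, hiR, -⟩ := exists_sibling_decomposition K Δ i
  refine ⟨i', hi', fun m hm hmi => ?_⟩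
  have hcoeff : coeff m (anf K (Δ + 1)) ≠ 0 := mem_support_iff.1 hm
  rw [hanf, coeff_add] at hcoeff
  have hR : coeff m R = 0 := by
    by_contra h
    exact hiR ((mem_vars_iff_mem_support i).2 ⟨m, mem_support_iff.2 h, Finsupp.mem_support_iff.2 hmi⟩)
  rw [hR, add_zero, show X i * X i' * P = X i' * (X i * P) by ring, coeff_X_mul'] at hcoeff
  split_ifs at hcoeff with h
  · exact Finsupp.mem_support_iff.1 h
  · exact absurd rfl hcoeff

/-- The halves of `ANF_{Δ+1}`: a monomial lives in blocks `{0,1}` or in blocks `{2,3}`, so the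
indicator "block of `x` is `0` or `1`" is constant on every monomial, and both values occur.
[cite: MediniShpilka2021, Obs 5.8 (arXiv p0025:L57-L60)] -/
theorem exists_halves_anf_succ (Δ : ℕ) :
    ∃ H : Fin (4 ^ (Δ + 1)) → Bool,
      (∀ μ ∈ (anf K (Δ + 1)).support, ∀ j j', μ j ≠ 0 → μ j' ≠ 0 → H j = H j') ∧
      (∃ j, H j = true) ∧ (∃ j, H j = false) := by
  classical
  obtain ⟨e, he⟩ := exists_equiv_anfBlock Δ
  refine ⟨fun x => decide (((e.symm x).1 : ℕ) < 2), ?_, ⟨e (0, ⟨0, pow_pos (by norm_num) Δ⟩), ?_⟩,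
    ⟨e (2, ⟨0, pow_pos (by norm_num) Δ⟩), ?_⟩⟩
  · intro μ hμ j j' hj hj'
    rw [anf_succ_eq_rename_block (K := K) Δ he, support_rename_of_injective e.injective,
      Finset.mem_image] at hμ
    obtain ⟨m, hm, rfl⟩ := hμ
    obtain ⟨b₀, hb₀, μ', -, ν', -, hdec⟩ := exists_decomp_of_mem_support_block (anf K Δ) hm
    have key : ∀ x, Finsupp.mapDomain e m x ≠ 0 → (((e.symm x).1 : ℕ) < 2 ↔ b₀ = 0) := by
      intro x hx
      obtain ⟨⟨b, i⟩, rfl⟩ := e.surjective x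
      rw [Finsupp.mapDomain_apply e.injective, hdec,
        mapDomain_mk_add_apply (one_sub_ne_self b₀).symm] at hx
      rw [Equiv.symm_apply_apply]
      have hb : b = b₀ ∨ b = 1 - b₀ := by
        by_contra hcon
        rw [not_or] at hcon
        rw [if_neg hcon.1, if_neg hcon.2, add_zero] at hx
        exact hx rfl
      rcases hb₀ with rfl | rfl <;> rcases hb with rfl | rfl <;> (dsimp only; decide)
    simp only [key j hj, key j' hj']
  · simp only [Equiv.symm_apply_apply, decide_eq_true_eq]; decide
  · simp only [Equiv.symm_apply_apply, decide_eq_false_iff_not]; decide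

/-- Independence of the first partials of the block polynomial (Cor. 5.10 for `ANF_{Δ+1}`,
transported along the block equivalence). [cite: MediniShpilka2021, Cor 5.10 (arXiv p0025:L61-L68)] -/
theorem sum_C_mul_pderiv_block_ne_zero (Δ : ℕ) (u : Fin 4 × Fin (4 ^ Δ) → K) (hu : u ≠ 0) :
    (∑ v, C (u v) * pderiv v
      (rename (Prod.mk (0 : Fin 4)) (anf K Δ) * rename (Prod.mk (1 : Fin 4)) (anf K Δ) +
        rename (Prod.mk (2 : Fin 4)) (anf K Δ) * rename (Prod.mk (3 : Fin 4)) (anf K Δ))) ≠ 0 := by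
  classical
  obtain ⟨e, he⟩ := exists_equiv_anfBlock Δ
  set B := rename (Prod.mk (0 : Fin 4)) (anf K Δ) * rename (Prod.mk (1 : Fin 4)) (anf K Δ) +
    rename (Prod.mk (2 : Fin 4)) (anf K Δ) * rename (Prod.mk (3 : Fin 4)) (anf K Δ) with hB
  intro h0
  have h1 : rename e (∑ v, C (u v) * pderiv v B) =
      ∑ x, C (u (e.symm x)) * pderiv x (anf K (Δ + 1)) := by
    rw [map_sum, anf_succ_eq_rename_block (K := K) Δ he]
    refine Fintype.sum_equiv e _ _ fun v => ?_
    rw [map_mul, rename_C, Equiv.symm_apply_apply, pderiv_rename e.injective]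
  have hu' : (fun x => u (e.symm x)) ≠ 0 := by
    intro h
    apply hu
    funext v
    have := congrFun h (e v)
    simpa only [Equiv.symm_apply_apply, Pi.zero_apply] using this
  have := sum_C_mul_pderiv_anf_ne_zero K (Δ + 1) _ hu'
  rw [← h1, h0, map_zero] at this
  exact this rfl

/-- `2 ≤ 2^{Δ+1}`. [cite: MediniShpilka2021, Def 8] -/
private theorem two_le_two_pow_succ (Δ : ℕ) : 2 ≤ 2 ^ (Δ + 1) := by
  rw [pow_succ]
  have := Nat.two_pow_pos Δ
  omega

/-! ### The linear substitution in `affSubst` form -/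

/-- `affSubst le_rfl M 0` is the linear substitution `q ↦ q(Mx)`.
[cite: MediniShpilka2021, §1.1.6 eq. (2) (arXiv p0007:L7-L10)] -/
theorem affSubst_le_rfl_zero_eq_aeval {m : ℕ} (M : Matrix (Fin m) (Fin m) K)
    (f : MvPolynomial (Fin m) K) :
    affSubst le_rfl M 0 f = aeval (fun v : Fin m => ∑ w, C (M v w) * X w) f := by
  unfold affSubst
  exact congrArg (fun F : Fin m → MvPolynomial (Fin m) K => aeval F f) (funext fun v => by
    simp only [Fin.castLE_rfl, id_eq, Pi.zero_apply, C_0, add_zero])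

/-- `affSubst le_rfl (diagonal α) 0` is the scaling `q ↦ q(α • x)`.
[cite: MediniShpilka2021, remark after Lemma 5.11 (arXiv p0027:L12-L16)] -/
theorem affSubst_le_rfl_diagonal_zero_eq_aeval {m : ℕ} (α : Fin m → K)
    (f : MvPolynomial (Fin m) K) :
    affSubst le_rfl (Matrix.diagonal α) 0 f = aeval (fun v : Fin m => C (α v) * X v) f := by
  rw [affSubst_le_rfl_zero_eq_aeval]
  exact congrArg (fun F : Fin m → MvPolynomial (Fin m) K => aeval F f) (funext fun v => by
    rw [Finset.sum_eq_single v (fun w _ hw => by rw [Matrix.diagonal_apply_ne _ (Ne.symm hw), C_0,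
      zero_mul]) (fun h => absurd (Finset.mem_univ v) h), Matrix.diagonal_apply_eq])

/-! ### The induction -/

/-- **Lemma 5.12, TR-free linear form, every `Δ`.** If `M ∈ GL_{4^Δ}` and
`mon(ANF_Δ(Mx)) ⊆ mon(ANF_Δ(x))` then `ANF_Δ(Mx) = ANF_Δ(α₁x₁, …, α_Nx_N)` with all `α_i ≠ 0`
(the tree symmetry of the printed statement is absorbed: "`(βℓ₁)(ℓ₂) + (γℓ₃)(ℓ₄)` is again an
ANF-leaf labelling of the same polynomial").
[cite: MediniShpilka2021, Lemma 5.12 (arXiv p0027:L40-L43) with its proof (p0028:L1-L40) and the remark after Lemma 5.11 (p0027:L12-L16)] -/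
theorem exists_units_of_support_linSubst_anf_subset :
    ∀ (Δ : ℕ) (M : Matrix (Fin (4 ^ Δ)) (Fin (4 ^ Δ)) K), IsUnit M.det →
      (aeval (fun v : Fin (4 ^ Δ) => ∑ w, C (M v w) * X w) (anf K Δ)).support ⊆ (anf K Δ).support →
      ∃ α : Fin (4 ^ Δ) → K, (∀ i, α i ≠ 0) ∧
        aeval (fun v : Fin (4 ^ Δ) => ∑ w, C (M v w) * X w) (anf K Δ) =
          aeval (fun v => C (α v) * X v) (anf K Δ)
  | 0, M, hM, _ => by
    classical
    set i₀ : Fin (4 ^ 0) := ⟨0, by norm_num⟩ with hi₀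
    have hall : ∀ w : Fin (4 ^ 0), w = i₀ := by
      intro w; ext; have := w.2; simp only [pow_zero] at this; simp only [hi₀]; omega
    haveI : Subsingleton (Fin (4 ^ 0)) := ⟨fun a b => by rw [hall a, hall b]⟩
    have hdet : M.det = M i₀ i₀ := Matrix.det_eq_elem_of_subsingleton M i₀
    refine ⟨fun _ => M i₀ i₀, fun _ => by rw [← hdet]; exact hM.ne_zero, ?_⟩
    have hanf : anf K 0 = X i₀ := rfl
    rw [hanf, aeval_X, aeval_X, Finset.sum_eq_single i₀ (fun w _ hw => absurd (hall w) hw)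
      (fun h => absurd (Finset.mem_univ _) h)]
  | 1, M, hM, hsupp => by
    classical
    have h' : (affSubst le_rfl M 0 (anf K 1)).support ⊆ (anf K 1).support := by
      rwa [affSubst_le_rfl_zero_eq_aeval]
    obtain ⟨-, π, α, hα, hπ, heq⟩ := anf_one_rigidity_of_support_subset hM 0 h'
    refine ⟨fun i => α (π.symm i), fun i => hα _, ?_⟩
    rw [← affSubst_le_rfl_zero_eq_aeval, heq]
    conv_rhs => rw [← hπ, aeval_rename]
    exact congrArg (fun F : Fin (4 ^ 1) → MvPolynomial (Fin (4 ^ 1)) K => aeval F (anf K 1))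
      (funext fun i => by simp only [Function.comp_apply, Equiv.symm_apply_apply])
  | Δ + 2, M, hM, hsupp => by
    classical
    obtain ⟨e, he⟩ := exists_equiv_anfBlock (Δ + 1)
    set A := anf K (Δ + 1) with hA
    set B := rename (Prod.mk (0 : Fin 4)) A * rename (Prod.mk (1 : Fin 4)) A +
      rename (Prod.mk (2 : Fin 4)) A * rename (Prod.mk (3 : Fin 4)) A with hB
    have hanf : anf K (Δ + 2) = rename e B := anf_succ_eq_rename_block (K := K) (Δ + 1) he
    -- the transported matrix
    set M' : Matrix (Fin 4 × Fin (4 ^ (Δ + 1))) (Fin 4 × Fin (4 ^ (Δ + 1))) K :=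
      fun v w => M (e v) (e w) with hM'
    have hM'det : IsUnit M'.det := by
      have : M' = M.submatrix e e := rfl
      rw [this, Matrix.det_submatrix_equiv_self]
      exact hM
    -- the two substitutions intertwine along `rename e`
    have hθ : ∀ q : MvPolynomial (Fin 4 × Fin (4 ^ (Δ + 1))) K,
        rename e (aeval (fun v : Fin 4 × Fin (4 ^ (Δ + 1)) => ∑ w, C (M' v w) * X w) q) =
        aeval (fun v : Fin (4 ^ (Δ + 2)) => ∑ w, C (M v w) * X w) (rename e q) := by
      intro q
      rw [aeval_rename, ← AlgHom.comp_apply, comp_aeval]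
      exact congrArg (fun F : Fin 4 × Fin (4 ^ (Δ + 1)) → MvPolynomial (Fin (4 ^ (Δ + 2))) K =>
        aeval F q) (funext fun v => by
          simp only [Function.comp_apply, map_sum, map_mul, rename_C, rename_X, hM']
          exact Fintype.sum_equiv e _ _ fun w => rfl)
    -- hypotheses of the block step
    have hsupp' : (aeval (fun v : Fin 4 × Fin (4 ^ (Δ + 1)) => ∑ w, C (M' v w) * X w) B).support ⊆
        B.support := by
      intro m hm
      have h1 : Finsupp.mapDomain e m ∈ (aeval (fun v : Fin (4 ^ (Δ + 2)) => ∑ w, C (M v w) * X w)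
          (anf K (Δ + 2))).support := by
        rw [hanf, ← hθ, support_rename_of_injective e.injective, Finset.mem_image]
        exact ⟨m, hm, rfl⟩
      have h2 := hsupp h1
      rw [hanf, support_rename_of_injective e.injective, Finset.mem_image] at h2
      obtain ⟨m', hm', hmm'⟩ := h2
      rwa [← Finsupp.mapDomain_injective e.injective hmm']
    obtain ⟨H, hH, hHt, hHf⟩ := exists_halves_anf_succ (K := K) Δ
    have IH := exists_units_of_support_linSubst_anf_subset (Δ + 1)
    obtain ⟨α', hα', heq'⟩ := block_step A (isHomogeneous_anf K (Δ + 1)) (two_le_two_pow_succ Δ)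
      (anf_ne_zero K (Δ + 1)) (degreeOf_anf_le_one K (Δ + 1))
      (exists_sibling_of_mem_support_anf (K := K) Δ) (sum_C_mul_pderiv_anf_ne_zero K (Δ + 1))
      H hH hHt hHf IH hB (sum_C_mul_pderiv_block_ne_zero (K := K) (Δ + 1)) M' hM'det hsupp'
    refine ⟨fun x => α' (e.symm x), fun x => hα' _, ?_⟩
    rw [hanf, ← hθ, heq', aeval_rename, ← AlgHom.comp_apply, comp_aeval]
    exact congrArg (fun F : Fin 4 × Fin (4 ^ (Δ + 1)) → MvPolynomial (Fin (4 ^ (Δ + 2))) K =>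
      aeval F B) (funext fun v => by
        simp only [Function.comp_apply, map_mul, rename_C, rename_X, Equiv.symm_apply_apply])

/-! ### The affine statement (`b = 0`) and the consumable corollaries -/

/-- **`b = 0`**: if `mon(ANF_Δ(Ax + b)) ⊆ mon(ANF_Δ)` then `b = 0` — the degree-`(2^Δ - 1)`
component of `ANF_Δ(Ax + b)` vanishes and equals `(∂ANF_Δ/∂b)(Ax)`, and the first partials of
`ANF_Δ` are linearly independent (Cor. 5.10).
[cite: MediniShpilka2021, Lemma 5.12, "then b = 0" (arXiv p0027:L42, p0028:L3-L6, L9)] -/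
theorem eq_zero_of_support_affSubst_anf_subset (Δ : ℕ) {A : Matrix (Fin (4 ^ Δ)) (Fin (4 ^ Δ)) K}
    (hA : IsUnit A.det) (b : Fin (4 ^ Δ) → K)
    (h : (affSubst le_rfl A b (anf K Δ)).support ⊆ (anf K Δ).support) : b = 0 := by
  classical
  set g := affSubst le_rfl A b (anf K Δ) with hg
  -- `g` is homogeneous of degree `2^Δ = d' + 1`
  obtain ⟨d', hd'⟩ : ∃ d', 2 ^ Δ = d' + 1 := ⟨2 ^ Δ - 1, by
    have := Nat.two_pow_pos Δ; omega⟩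
  have hghom : g.IsHomogeneous (d' + 1) := by
    intro m hm
    rw [← hd']
    exact isHomogeneous_anf K Δ (mem_support_iff.1 (h (mem_support_iff.2 hm)))
  have hcomp : homogeneousComponent d' g = 0 := by
    rw [homogeneousComponent_of_mem hghom, if_neg (by omega)]
  -- `g = (ANF(Ax))(x + γ)` with `A γ = b`
  set γ : Fin (4 ^ Δ) → K := A⁻¹ *ᵥ b with hγ
  have hAγ : A *ᵥ γ = b := by
    rw [hγ, Matrix.mulVec_mulVec, Matrix.mul_nonsing_inv A hA, Matrix.one_mulVec]
  have hg' : g = affSubst le_rfl 1 γ (affSubst le_rfl A 0 (anf K Δ)) := by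
    rw [affSubst_one_affSubst_zero, hAγ]
  have hlin : (affSubst le_rfl A 0 (anf K Δ)).IsHomogeneous (d' + 1) := by
    rw [affSubst_le_rfl_zero_eq_aeval, ← hd']
    exact isHomogeneous_aeval_linSubst A (isHomogeneous_anf K Δ)
  rw [hg', homogeneousComponent_affSubst_one γ hlin] at hcomp
  -- chain rule: `Σ_i γ_i ∂_i (ANF(Ax)) = (Σ_v (Aγ)_v ∂_v ANF)(Ax)`
  have hchain : (∑ i, C (γ i) * pderiv i (affSubst le_rfl A 0 (anf K Δ))) =
      aeval (fun v : Fin (4 ^ Δ) => ∑ w, C (A v w) * X w)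
        (∑ v, C (b v) * pderiv v (anf K Δ)) := by
    set θ := (aeval (fun v : Fin (4 ^ Δ) => ∑ w, C (A v w) * X w) :
      MvPolynomial (Fin (4 ^ Δ)) K →ₐ[K] MvPolynomial (Fin (4 ^ Δ)) K) with hθ
    have e1 : ∀ i, C (γ i) * pderiv i (affSubst le_rfl A 0 (anf K Δ)) =
        θ (C (γ i) * ∑ v, C (A v i) * pderiv v (anf K Δ)) := by
      intro i
      rw [affSubst_le_rfl_zero_eq_aeval, pderiv_aeval_linSubst (fun v w => A v w) i, map_mul,
        algHom_C, algebraMap_eq]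
    simp_rw [e1]
    rw [← map_sum]
    congr 1
    simp_rw [Finset.mul_sum, ← mul_assoc, ← map_mul]
    rw [Finset.sum_comm]
    refine Finset.sum_congr rfl fun v _ => ?_
    rw [← Finset.sum_mul, ← map_sum, ← hAγ]
    simp only [Matrix.mulVec, dotProduct, mul_comm (A v _) (γ _)]
  rw [hchain, ← map_zero (aeval (fun v : Fin (4 ^ Δ) => ∑ w, C (A v w) * X w) :
    MvPolynomial (Fin (4 ^ Δ)) K →ₐ[K] MvPolynomial (Fin (4 ^ Δ)) K)] at hcomp
  have h0 := aeval_linSubst_injective A hA hcomp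
  by_contra hb
  exact sum_C_mul_pderiv_anf_ne_zero K Δ b hb h0

/-- The top homogeneous component: `mon(ANF_Δ(Ax + b)) ⊆ mon(ANF_Δ)` gives `ANF_Δ(Ax + b) = ANF_Δ(Ax)`
and hence `mon(ANF_Δ(Ax)) ⊆ mon(ANF_Δ)`.
[cite: MediniShpilka2021, proof of Lemma 5.12 (arXiv p0028:L9: "`ANF(Ax+b)^{[2^Δ]} = ANF(Ax)`")] -/
theorem support_affSubst_zero_subset_of_support_affSubst_subset (Δ : ℕ)
    {A : Matrix (Fin (4 ^ Δ)) (Fin (4 ^ Δ)) K} (hA : IsUnit A.det) (b : Fin (4 ^ Δ) → K)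
    (h : (affSubst le_rfl A b (anf K Δ)).support ⊆ (anf K Δ).support) :
    (affSubst le_rfl A 0 (anf K Δ)).support ⊆ (anf K Δ).support := by
  rwa [eq_zero_of_support_affSubst_anf_subset Δ hA b h] at h

/-- **MS21 Lemma 5.12 (TR-free form of the sizing memo, every `Δ`)**: if
`mon(ANF_Δ(Ax + b)) ⊆ mon(ANF_Δ)` with `A ∈ GL_{4^Δ}`, then `b = 0` and
`ANF_Δ(Ax) = ANF_Δ(α • x ∘ π)` for a permutation `π` fixing `ANF_Δ` (here `π = 1`) and nonzero
scalars `α`. [cite: MediniShpilka2021, Lemma 5.12 (arXiv p0027:L40-L43) and remark after Lemma 5.11 (p0027:L12-L16)] -/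
theorem anf_rigidity_of_support_subset (Δ : ℕ) {A : Matrix (Fin (4 ^ Δ)) (Fin (4 ^ Δ)) K}
    (hA : IsUnit A.det) (b : Fin (4 ^ Δ) → K)
    (h : (affSubst le_rfl A b (anf K Δ)).support ⊆ (anf K Δ).support) :
    b = 0 ∧ ∃ (π : Equiv.Perm (Fin (4 ^ Δ))) (α : Fin (4 ^ Δ) → K), (∀ i, α i ≠ 0) ∧
      rename π (anf K Δ) = anf K Δ ∧
      affSubst le_rfl A 0 (anf K Δ) = aeval (fun i => C (α i) * X (π i)) (anf K Δ) := by
  have hb := eq_zero_of_support_affSubst_anf_subset Δ hA b h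
  subst hb
  rw [affSubst_le_rfl_zero_eq_aeval] at h
  obtain ⟨α, hα, heq⟩ := exists_units_of_support_linSubst_anf_subset Δ A hA h
  refine ⟨rfl, 1, α, hα, by rw [Equiv.Perm.coe_one, rename_id, AlgHom.id_apply], ?_⟩
  rw [affSubst_le_rfl_zero_eq_aeval, heq]
  rfl

/-- **MS21 Lemma 5.12 for the `MS2021_thm_35` core (diagonal form)**: if
`mon(ANF_Δ(Mx)) ⊆ mon(ANF_Δ)` with `M ∈ GL_{4^Δ}`, then `ANF_Δ(Mx) = ANF_Δ(diag(α) x)` with all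
`α_i ≠ 0` — the input of (lem:pitRoanfSame), Case (case:different) of Lemma 5.11.
[cite: MediniShpilka2021, Lemma 5.12 (arXiv p0027:L40-L43), Lemma 5.11 Case (ii) (p0027:L5-L20)] -/
theorem exists_units_of_support_affSubst_anf_subset (Δ : ℕ)
    {M : Matrix (Fin (4 ^ Δ)) (Fin (4 ^ Δ)) K} (hM : IsUnit M.det)
    (h : (affSubst le_rfl M 0 (anf K Δ)).support ⊆ (anf K Δ).support) :
    ∃ α : Fin (4 ^ Δ) → K, (∀ i, α i ≠ 0) ∧
      affSubst le_rfl M 0 (anf K Δ) = aeval (fun i => C (α i) * X i) (anf K Δ) ∧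
      affSubst le_rfl M 0 (anf K Δ) = affSubst le_rfl (Matrix.diagonal α) 0 (anf K Δ) := by
  rw [affSubst_le_rfl_zero_eq_aeval] at h ⊢
  obtain ⟨α, hα, heq⟩ := exists_units_of_support_linSubst_anf_subset Δ M hM h
  exact ⟨α, hα, heq, by rw [affSubst_le_rfl_diagonal_zero_eq_aeval, heq]⟩

/-- **Lemma 5.12 in the `h512` binder of the `MS2021_thm_35` assembly**
(`MS2021_thm_35_of_h512_hstruct`, seat x5 g3): for every field `K`, depth `Δ` and `M ∈ GL_{4^Δ}(K)`,
`mon(ANF_Δ(Mx)) ⊆ mon(ANF_Δ)` gives `ANF_Δ(Mx) = ANF_Δ(α • x ∘ π)` with `π` fixing `ANF_Δ`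
(here `π = 1`) and all `α_i ≠ 0`.
[cite: MediniShpilka2021, Lemma 5.12 (arXiv p0027:L40-L43) and remark after Lemma 5.11 (p0027:L12-L16)] -/
theorem anf_h512 : ∀ (K : Type) [Field K] (Δ : ℕ) (M : Matrix (Fin (4 ^ Δ)) (Fin (4 ^ Δ)) K),
    IsUnit M.det → (affSubst le_rfl M 0 (anf K Δ)).support ⊆ (anf K Δ).support →
    ∃ (π : Equiv.Perm (Fin (4 ^ Δ))) (α : Fin (4 ^ Δ) → K), (∀ i, α i ≠ 0) ∧
      rename π (anf K Δ) = anf K Δ ∧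
      affSubst le_rfl M 0 (anf K Δ) = aeval (fun i => C (α i) * X (π i)) (anf K Δ) :=
  fun _ _ Δ _ hM h => (anf_rigidity_of_support_subset Δ hM 0 h).2

/-! ### "In particular, `mon(g) = mon(ANF_Δ)`" -/

/-- Coefficients under the diagonal scaling `x_i ↦ α_i x_i`: `coeff_m(p(α • x)) = α^m · coeff_m(p)`.
[cite: MediniShpilka2021, remark after Lemma 5.11 (arXiv p0027:L12-L16), book-keeping] -/
theorem coeff_aeval_C_mul_X {σ : Type*} (α : σ → K) (p : MvPolynomial σ K) (m : σ →₀ ℕ) :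
    coeff m (aeval (fun i => C (α i) * X i) p) = (m.prod fun i e => α i ^ e) * coeff m p := by
  classical
  have hmon : ∀ (d : σ →₀ ℕ) (r : K), aeval (fun i => C (α i) * X i) (monomial d r) =
      monomial d ((d.prod fun i e => α i ^ e) * r) := by
    intro d r
    rw [aeval_eq_bind₁, bind₁_monomial, monomial_eq, Finsupp.prod, Finsupp.prod, map_mul, map_prod]
    simp_rw [mul_pow, ← map_pow]
    rw [Finset.prod_mul_distrib]
    ring
  conv_lhs => rw [p.as_sum, map_sum]
  simp_rw [hmon, coeff_sum, coeff_monomial]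
  rw [Finset.sum_ite_eq' p.support m]
  split_ifs with h
  · rfl
  · rw [notMem_support_iff.1 h, mul_zero]

/-- The diagonal scaling by nonzero scalars preserves the set of monomials.
[cite: MediniShpilka2021, remark after Lemma 5.11 (arXiv p0027:L12-L16)] -/
theorem support_aeval_C_mul_X {σ : Type*} {α : σ → K} (hα : ∀ i, α i ≠ 0) (p : MvPolynomial σ K) :
    (aeval (fun i => C (α i) * X i) p).support = p.support := by
  ext m
  rw [mem_support_iff, mem_support_iff, coeff_aeval_C_mul_X, mul_ne_zero_iff]
  exact and_iff_right (by
    rw [Finsupp.prod]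
    exact Finset.prod_ne_zero_iff.2 fun i _ => pow_ne_zero _ (hα i))

/-- **Lemma 5.12, "In particular, `mon(g) = mon(ANF_Δ(x))`"**: for `M ∈ GL_{4^Δ}`, the inclusion
`mon(ANF_Δ(Mx)) ⊆ mon(ANF_Δ)` is an equality. [cite: MediniShpilka2021, Lemma 5.12, last sentence (arXiv p0027:L43)] -/
theorem support_affSubst_anf_eq_of_subset (Δ : ℕ) {M : Matrix (Fin (4 ^ Δ)) (Fin (4 ^ Δ)) K}
    (hM : IsUnit M.det) (h : (affSubst le_rfl M 0 (anf K Δ)).support ⊆ (anf K Δ).support) :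
    (affSubst le_rfl M 0 (anf K Δ)).support = (anf K Δ).support := by
  obtain ⟨α, hα, heq, -⟩ := exists_units_of_support_affSubst_anf_subset Δ hM h
  rw [heq, support_aeval_C_mul_X hα]

end MS2021

end Literature.Computability.AlgebraicComplexity

end
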